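import Literature.Analysis.FluidPDE.AxisymmetricNoSwirlGlobalHolds
import Summits.NavierStokesRegularity.NavierStokesRegularity.Theorems.CertifiedBlowupCertifiedBlowupAxisymBlowupKatoLifespan

/-!
# Swirl is essential for the crux `CertifiedBlowupAxisymBlowup` (stmt-NavierStokesRegularity-0727)

Theorems file landed `--supports stmt-NavierStokesRegularity-0727`, line `compact-amplification`
(continuation lead c1, cycle 2). The crux asks for an axisymmetric rapidly decaying datum whose
maximal Leray–Hopf classical development has finite lifespan. The item's informal text lists the
constraints a construction must respect; the first — "no-swirl data are globally regular, so swirl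
is essential" — is a THEOREM of the tree (ns.S24, discharged:
`axisymmetric_no_swirl_global_regularity_holds`, Ladyzhenskaya / Ukhovskii–Yudovich 1968), and
this file records its kernel-checked consequences for the crux:

* `katoMaximalTime_eq_top_of_hasNoSwirl`: an axisymmetric swirl-free Clay datum has infinite
  Kato maximal time;
* `not_hasNoSwirl_of_isMaximalSmoothSolution`: the datum of every witness of the crux carries
  swirl (`¬ HasNoSwirl (u 0)`, i.e. `Γ = r u_θ ≢ 0`);
* `certifiedBlowupAxisymBlowup_iff_exists_withSwirl`: the crux is equivalent to its strengthening
  by the clause `¬ HasNoSwirl (u 0)` — every admissible witness lives in the axisymmetric class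
  WITH swirl (the habitat of ns.S25 and of Hou's scenario).

## References

* O. A. Ladyzhenskaya, Zap. Naučn. Sem. LOMI 7 (1968); M. R. Ukhovskii, V. I. Yudovich, J. Appl.
  Math. Mech. 32 (1968).
* P. G. Lemarié-Rieusset, *The Navier–Stokes Problem in the 21st Century*, CRC 2016, Thm. 10.4.
-/

set_option linter.dupNamespace false

noncomputable section

open MeasureTheory Set Function Filter Topology Metric
open scoped ENNReal NNReal ContDiff

namespace Summit.NavierStokesRegularity.NavierStokesRegularity.Theorems.CertifiedBlowupAxisymBlowup.CompactAmplification

open Literature.Analysis.FluidPDE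
open Summit.NavierStokesRegularity.NavierStokesRegularity.Theses.CertifiedBlowup

/-- **Swirl-free axisymmetric data have infinite Kato maximal time** (ns.S24,
`axisymmetric_no_swirl_global_regularity_holds`, gives the global classical bounded-energy
solution; `katoMaximalTime_eq_top_of_global_classical` converts it).
[cite: LemarieRieusset2016, Thm 10.4 (p. 285)] -/
theorem katoMaximalTime_eq_top_of_hasNoSwirl {ν : ℝ} (hν : 0 < ν)
    {u₀ : EuclideanSpace ℝ (Fin 3) → EuclideanSpace ℝ (Fin 3)} (hsm : ContDiff ℝ ∞ u₀)
    (hdiv : VectorCalculus.IsDivFree u₀) (hdec : HasRapidSpatialDecay u₀) (hax : IsAxisymmetric u₀)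
    (hsw : HasNoSwirl u₀) : katoMaximalTime ν u₀ = ⊤ := by
  obtain ⟨U, P, hU, hU0, hE, -⟩ :=
    axisymmetric_no_swirl_global_regularity_holds ν hν u₀ hsm hdiv hdec hax hsw
  exact katoMaximalTime_eq_top_of_global_classical hν hdec hU hU0 hE

/-- **The datum of a witness of the crux carries swirl.** If `(u, p)` is a maximal smooth solution
of finite lifespan `T`, Leray–Hopf on `[0, T]` from its rapidly decaying axisymmetric datum `u 0`,
then `u 0` is NOT swirl-free: otherwise ns.S24 supplies a global classical bounded-energy solution
from `u 0`, excluded by `clayOrBlowup_exclusive` (Clay-class uniqueness X5b).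
[cite: LemarieRieusset2016, Thm 10.4 (p. 285)] -/
theorem not_hasNoSwirl_of_isMaximalSmoothSolution {ν T : ℝ} (hν : 0 < ν) (hT : 0 < T)
    {u : ℝ → EuclideanSpace ℝ (Fin 3) → EuclideanSpace ℝ (Fin 3)}
    {p : ℝ → EuclideanSpace ℝ (Fin 3) → ℝ} (hmax : IsMaximalSmoothSolution ν 0 u p T)
    (hLH : IsLerayHopfOn T ν 0 (u 0) u) (hdec : HasRapidSpatialDecay (u 0))
    (hax : IsAxisymmetric (u 0)) : ¬ HasNoSwirl (u 0) := by
  intro hsw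
  have h0T : (0 : ℝ) ∈ Ico 0 T := ⟨le_rfl, hT⟩
  obtain ⟨U, P, hU, hU0, hE, -⟩ :=
    axisymmetric_no_swirl_global_regularity_holds ν hν (u 0) (hmax.1.contDiff_velocity h0T)
      (hmax.1.divFree 0 h0T) hdec hax hsw
  exact clayOrBlowup_exclusive hν hdec hU hU0 hE hT hmax hLH rfl

/-- **The crux lives in the class WITH swirl.** `CertifiedBlowupAxisymBlowup` is equivalent to the
same statement with the extra clause that the datum has swirl (`¬ HasNoSwirl (u 0)`): every
witness satisfies it by `not_hasNoSwirl_of_isMaximalSmoothSolution`. [folklore] -/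
theorem certifiedBlowupAxisymBlowup_iff_exists_withSwirl :
    Summit.NavierStokesRegularity.NavierStokesRegularity.Theses.CertifiedBlowup.CertifiedBlowupAxisymBlowup ↔
      ∃ ν : ℝ, 0 < ν ∧ ∃ T : ℝ, 0 < T ∧
        ∃ (u : ℝ → EuclideanSpace ℝ (Fin 3) → EuclideanSpace ℝ (Fin 3))
          (p : ℝ → EuclideanSpace ℝ (Fin 3) → ℝ),
          IsMaximalSmoothSolution ν 0 u p T ∧ IsLerayHopfOn T ν 0 (u 0) u ∧
            HasRapidSpatialDecay (u 0) ∧ IsAxisymmetric (u 0) ∧ ¬ HasNoSwirl (u 0) := by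
  constructor
  · rintro ⟨ν, hν, T, hT, u, p, hmax, hLH, hdec, hax⟩
    exact ⟨ν, hν, T, hT, u, p, hmax, hLH, hdec, hax,
      not_hasNoSwirl_of_isMaximalSmoothSolution hν hT hmax hLH hdec hax⟩
  · rintro ⟨ν, hν, T, hT, u, p, hmax, hLH, hdec, hax, -⟩
    exact ⟨ν, hν, T, hT, u, p, hmax, hLH, hdec, hax⟩

/-- **Kato form: a finite Kato maximal time in the axisymmetric class forces swirl.** If an
axisymmetric Clay datum has `katoMaximalTime ν u₀ < ∞` then it is not swirl-free (contrapositive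
of `katoMaximalTime_eq_top_of_hasNoSwirl`); with
`certifiedBlowupAxisymBlowup_iff_exists_katoMaximalTime_lt_top` this is the solution-free form of
"swirl is essential". [folklore] -/
theorem not_hasNoSwirl_of_katoMaximalTime_lt_top {ν : ℝ} (hν : 0 < ν)
    {u₀ : EuclideanSpace ℝ (Fin 3) → EuclideanSpace ℝ (Fin 3)} (hsm : ContDiff ℝ ∞ u₀)
    (hdiv : VectorCalculus.IsDivFree u₀) (hdec : HasRapidSpatialDecay u₀) (hax : IsAxisymmetric u₀)
    (hlt : katoMaximalTime ν u₀ < ⊤) : ¬ HasNoSwirl u₀ := fun hsw =>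
  hlt.ne (katoMaximalTime_eq_top_of_hasNoSwirl hν hsm hdiv hdec hax hsw)

end Summit.NavierStokesRegularity.NavierStokesRegularity.Theorems.CertifiedBlowupAxisymBlowup.CompactAmplification

end
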